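import Mathlib
import HarnessLib
import Summits.AtomisticToContinuum.FouriersLaw.Theorems.VanishingNoiseTransferNoisyFourierThomsonWitnessBlocks

/-!
# The Thomson witness of the velocity-flip pinned chain, II: the Poisson bracket of a bond term
(`--supports` file for crux `VanishingNoiseTransfer.NoisyFourier`, stmt-AtomisticToContinuum-11977, line
`abel-storage-decay`, stub B `stub_bulkAbelGKPositivity`; part W3 "WitnessAlgebra", file 2 of 4)

The Thomson witness (file I: `…ThomsonWitnessBlocks`) is `v = Σ_{bonds (i, j = i+1)} (p_i G + p_j G')` with
`G = p_j² φ'(r) − H_j φ(r)`, `G' = p_i² φ'(r) + H_i φ(r)`, `r = q_j − q_i`, `φ = 1/V''`, `H_k = ∂_{q_k} H`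
(pinned chain `pinnedChain ω₂ lam β γ`; everything is written inline, this file introduces no definitions).
Here we compute the Hamiltonian vector field `X = {H, ·}` on ONE bond term:
* `partialQ_bond`, `partialP_bond` — all coordinate partials `∂_{q_l}`, `∂_{p_l}` of `p_i G + p_j G'`, by the
  product rule on the coordinate slices of file I (linear in the `l`-dependent atoms `δ_{jl} − δ_{il}`,
  `∂²Φ/∂q_l∂q_j`, `∂²Φ/∂q_l∂q_i`, `δ_{il}`, `δ_{jl}`);
* Kronecker and tridiagonal collapses of the sum over `l` (`sum_snd_mul_delta_sub`, `sum_mul_delta`,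
  `sum_mul_ite_delta`, `sum_ite_eq_of_bond`, `sum_snd_mul_hessPotential_right/left`);
* `poisson_bond` — THE BOND IDENTITY `{H, p_i G + p_j G'} = (p_i² − p_j²) + p_i R_A + p_j R_B` with the explicit
  `R_A = p_j (p_j² φ'' − ∂²_{q_j}H φ − 3 H_j φ') + (Σ_{k = j+1} p_k V''(q_k − q_j)) φ` (free of `p_i`) and
  `R_B = p_i (−p_i² φ'' + ∂²_{q_i}H φ − 3 H_i φ') − (Σ_{i = k+1} p_k V''(q_i − q_k)) φ` (free of `p_j`); all terms cancel
  literally except `−∂²Φ/∂q_i∂q_j · φ · (p_i² − p_j²) = V''(r) φ(r) (p_i² − p_j²) = p_i² − p_j²`;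
  `poisson_bond_ite` — the guarded version (zero off the bonds); registered as `helper_thomsonWitnessPoissonBond`.
The sum over the bonds, the telescoping `Σ_bonds (p_i² − p_j²) = p_0² − p_{L−1}²` and the pattern identity are file
III (`…ThomsonWitnessPattern`). All statements are [folklore] calculus; axioms `propext`, `Classical.choice`,
`Quot.sound` only.
-/

noncomputable section

open MeasureTheory Filter Topology
open scoped BigOperators ContDiff
open Literature.MathematicalPhysics.KineticTheory.HeatConduction

namespace Summit.AtomisticToContinuum.FouriersLaw.Theorems.NoisyFourier.ThomsonWitness.Algebra

variable {L : ℕ} {ω₂ lam β γ : ℝ}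

/-! ### Differentiability of the bond term -/

/-- The bond term `A + B = p_i G + p_j G'` is differentiable (`β ≥ 0`). [folklore] -/
theorem differentiable_bond (hβ : 0 ≤ β) (i j : Fin L) :
    Differentiable ℝ (fun x : PhaseSpace L =>
      x.2 i * (x.2 j ^ 2 * (-(6 * β * (x.1 j - x.1 i)) / (1 + 3 * β * (x.1 j - x.1 i) ^ 2) ^ 2) -
          partialQ j ((pinnedChain ω₂ lam β γ).hamiltonian L) x * (1 / (1 + 3 * β * (x.1 j - x.1 i) ^ 2))) +
        x.2 j * (x.2 i ^ 2 * (-(6 * β * (x.1 j - x.1 i)) / (1 + 3 * β * (x.1 j - x.1 i) ^ 2) ^ 2) +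
          partialQ i ((pinnedChain ω₂ lam β γ).hamiltonian L) x * (1 / (1 + 3 * β * (x.1 j - x.1 i) ^ 2)))) :=
  (contDiff_bond hβ i j).differentiable (by simp)

/-- The guarded bond term is differentiable (`β ≥ 0`). [folklore] -/
theorem differentiable_bond_ite (hβ : 0 ≤ β) (i j : Fin L) :
    Differentiable ℝ fun x : PhaseSpace L => if j.val = i.val + 1 then
      (x.2 i * (x.2 j ^ 2 * (-(6 * β * (x.1 j - x.1 i)) / (1 + 3 * β * (x.1 j - x.1 i) ^ 2) ^ 2) -
          partialQ j ((pinnedChain ω₂ lam β γ).hamiltonian L) x * (1 / (1 + 3 * β * (x.1 j - x.1 i) ^ 2))) +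
        x.2 j * (x.2 i ^ 2 * (-(6 * β * (x.1 j - x.1 i)) / (1 + 3 * β * (x.1 j - x.1 i) ^ 2) ^ 2) +
          partialQ i ((pinnedChain ω₂ lam β γ).hamiltonian L) x * (1 / (1 + 3 * β * (x.1 j - x.1 i) ^ 2))))
      else 0 :=
  (contDiff_bond_ite hβ i j).differentiable (by simp)

/-! ### The coordinate partials of the bond term -/

/-- `∂_{q_l}` of the bond term `p_i G + p_j G'` of the bond `(i, j)`: the slice along `q_l` is differentiated with the
product rule from the slices of `φ`, `φ'` (`hasDerivAt_phi_update`, `hasDerivAt_dphi_update`) and of `∂_{q_k} H`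
(`hasDerivAt_partialQ_hamiltonian_update`); the result is linear in the `l`-dependent atoms
`δ_{jl} − δ_{il}`, `∂²Φ/∂q_l∂q_j`, `∂²Φ/∂q_l∂q_i`. [folklore] -/
theorem partialQ_bond (hβ : 0 ≤ β) (i j l : Fin L) (x : PhaseSpace L) :
    partialQ l (fun y : PhaseSpace L =>
      y.2 i * (y.2 j ^ 2 * (-(6 * β * (y.1 j - y.1 i)) / (1 + 3 * β * (y.1 j - y.1 i) ^ 2) ^ 2) -
          partialQ j ((pinnedChain ω₂ lam β γ).hamiltonian L) y * (1 / (1 + 3 * β * (y.1 j - y.1 i) ^ 2))) +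
        y.2 j * (y.2 i ^ 2 * (-(6 * β * (y.1 j - y.1 i)) / (1 + 3 * β * (y.1 j - y.1 i) ^ 2) ^ 2) +
          partialQ i ((pinnedChain ω₂ lam β γ).hamiltonian L) y * (1 / (1 + 3 * β * (y.1 j - y.1 i) ^ 2)))) x =
      ((if j = l then 1 else 0) - (if i = l then 1 else 0)) *
          (x.2 i * (x.2 j ^ 2 * (6 * β * (9 * β * (x.1 j - x.1 i) ^ 2 - 1) / (1 + 3 * β * (x.1 j - x.1 i) ^ 2) ^ 3) -
              partialQ j ((pinnedChain ω₂ lam β γ).hamiltonian L) x * (-(6 * β * (x.1 j - x.1 i)) / (1 + 3 * β * (x.1 j - x.1 i) ^ 2) ^ 2)) +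
            x.2 j * (x.2 i ^ 2 * (6 * β * (9 * β * (x.1 j - x.1 i) ^ 2 - 1) / (1 + 3 * β * (x.1 j - x.1 i) ^ 2) ^ 3) +
              partialQ i ((pinnedChain ω₂ lam β γ).hamiltonian L) x * (-(6 * β * (x.1 j - x.1 i)) / (1 + 3 * β * (x.1 j - x.1 i) ^ 2) ^ 2))) +
        (pinnedChain ω₂ lam β γ).hessPotential L j l x.1 * (-(x.2 i * (1 / (1 + 3 * β * (x.1 j - x.1 i) ^ 2)))) +
        (pinnedChain ω₂ lam β γ).hessPotential L i l x.1 * (x.2 j * (1 / (1 + 3 * β * (x.1 j - x.1 i) ^ 2))) := by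
  have key : HasDerivAt (fun t => (fun y : PhaseSpace L =>
      y.2 i * (y.2 j ^ 2 * (-(6 * β * (y.1 j - y.1 i)) / (1 + 3 * β * (y.1 j - y.1 i) ^ 2) ^ 2) -
          partialQ j ((pinnedChain ω₂ lam β γ).hamiltonian L) y * (1 / (1 + 3 * β * (y.1 j - y.1 i) ^ 2))) +
        y.2 j * (y.2 i ^ 2 * (-(6 * β * (y.1 j - y.1 i)) / (1 + 3 * β * (y.1 j - y.1 i) ^ 2) ^ 2) +
          partialQ i ((pinnedChain ω₂ lam β γ).hamiltonian L) y * (1 / (1 + 3 * β * (y.1 j - y.1 i) ^ 2))))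
      (Function.update x.1 l t, x.2)) _ (x.1 l) :=
    ((((hasDerivAt_dphi_update hβ x.1 i j l).const_mul (x.2 j ^ 2)).fun_sub
        ((hasDerivAt_partialQ_hamiltonian_update x j l).fun_mul (hasDerivAt_phi_update hβ x.1 i j l))).const_mul
        (x.2 i)).fun_add
      ((((hasDerivAt_dphi_update hβ x.1 i j l).const_mul (x.2 i ^ 2)).fun_add
        ((hasDerivAt_partialQ_hamiltonian_update x i l).fun_mul (hasDerivAt_phi_update hβ x.1 i j l))).const_mul
        (x.2 j))
  refine key.deriv.trans ?_
  simp only [Function.update_eq_self, Prod.mk.eta]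
  ring

/-- `∂_{p_l}` of the bond term `p_i G + p_j G'`: `δ_{il} G + δ_{jl} G' + 2 p_i p_j φ'(r) (δ_{jl} + δ_{il})`
(`G, G'` involve the momenta only through `p_j²`, `p_i²`). [folklore] -/
theorem partialP_bond (i j l : Fin L) (x : PhaseSpace L) :
    partialP l (fun y : PhaseSpace L =>
      y.2 i * (y.2 j ^ 2 * (-(6 * β * (y.1 j - y.1 i)) / (1 + 3 * β * (y.1 j - y.1 i) ^ 2) ^ 2) -
          partialQ j ((pinnedChain ω₂ lam β γ).hamiltonian L) y * (1 / (1 + 3 * β * (y.1 j - y.1 i) ^ 2))) +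
        y.2 j * (y.2 i ^ 2 * (-(6 * β * (y.1 j - y.1 i)) / (1 + 3 * β * (y.1 j - y.1 i) ^ 2) ^ 2) +
          partialQ i ((pinnedChain ω₂ lam β γ).hamiltonian L) y * (1 / (1 + 3 * β * (y.1 j - y.1 i) ^ 2)))) x =
      (if i = l then 1 else 0) * (x.2 j ^ 2 * (-(6 * β * (x.1 j - x.1 i)) / (1 + 3 * β * (x.1 j - x.1 i) ^ 2) ^ 2) -
          partialQ j ((pinnedChain ω₂ lam β γ).hamiltonian L) x * (1 / (1 + 3 * β * (x.1 j - x.1 i) ^ 2))) +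
        (if j = l then 1 else 0) * (x.2 i ^ 2 * (-(6 * β * (x.1 j - x.1 i)) / (1 + 3 * β * (x.1 j - x.1 i) ^ 2) ^ 2) +
          partialQ i ((pinnedChain ω₂ lam β γ).hamiltonian L) x * (1 / (1 + 3 * β * (x.1 j - x.1 i) ^ 2))) +
        (if j = l then 2 * x.2 j else 0) * (x.2 i * (-(6 * β * (x.1 j - x.1 i)) / (1 + 3 * β * (x.1 j - x.1 i) ^ 2) ^ 2)) +
        (if i = l then 2 * x.2 i else 0) * (x.2 j * (-(6 * β * (x.1 j - x.1 i)) / (1 + 3 * β * (x.1 j - x.1 i) ^ 2) ^ 2)) := by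
  have key : HasDerivAt (fun t => (fun y : PhaseSpace L =>
      y.2 i * (y.2 j ^ 2 * (-(6 * β * (y.1 j - y.1 i)) / (1 + 3 * β * (y.1 j - y.1 i) ^ 2) ^ 2) -
          partialQ j ((pinnedChain ω₂ lam β γ).hamiltonian L) y * (1 / (1 + 3 * β * (y.1 j - y.1 i) ^ 2))) +
        y.2 j * (y.2 i ^ 2 * (-(6 * β * (y.1 j - y.1 i)) / (1 + 3 * β * (y.1 j - y.1 i) ^ 2) ^ 2) +
          partialQ i ((pinnedChain ω₂ lam β γ).hamiltonian L) y * (1 / (1 + 3 * β * (y.1 j - y.1 i) ^ 2))))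
      (x.1, Function.update x.2 l t)) _ (x.2 l) :=
    ((hasDerivAt_update_apply x.2 l i (x.2 l)).fun_mul
        (((hasDerivAt_update_apply_sq x.2 l j).mul_const (-(6 * β * (x.1 j - x.1 i)) / (1 + 3 * β * (x.1 j - x.1 i) ^ 2) ^ 2)).fun_sub
          ((hasDerivAt_partialQ_hamiltonian_update_snd (ω₂ := ω₂) (lam := lam) (β := β) (γ := γ) x j l
            (x.2 l)).mul_const (1 / (1 + 3 * β * (x.1 j - x.1 i) ^ 2))))).fun_add
      ((hasDerivAt_update_apply x.2 l j (x.2 l)).fun_mul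
        (((hasDerivAt_update_apply_sq x.2 l i).mul_const (-(6 * β * (x.1 j - x.1 i)) / (1 + 3 * β * (x.1 j - x.1 i) ^ 2) ^ 2)).fun_add
          ((hasDerivAt_partialQ_hamiltonian_update_snd (ω₂ := ω₂) (lam := lam) (β := β) (γ := γ) x i l
            (x.2 l)).mul_const (1 / (1 + 3 * β * (x.1 j - x.1 i) ^ 2)))))
  refine key.deriv.trans ?_
  simp only [Function.update_eq_self, Prod.mk.eta]
  ring

/-! ### Collapsing the sum over the coordinate index -/

/-- Kronecker collapse `Σ_l p_l (δ_{jl} − δ_{il}) = p_j − p_i`. [folklore] -/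
theorem sum_snd_mul_delta_sub (i j : Fin L) (p : Fin L → ℝ) :
    ∑ l : Fin L, p l * ((if j = l then (1 : ℝ) else 0) - (if i = l then 1 else 0)) = p j - p i := by
  simp only [mul_sub, Finset.sum_sub_distrib, mul_ite, mul_one, mul_zero, Finset.sum_ite_eq, Finset.mem_univ,
    if_true]

/-- Kronecker collapse `Σ_l a_l δ_{kl} = a_k`. [folklore] -/
theorem sum_mul_delta (k : Fin L) (a : Fin L → ℝ) :
    ∑ l : Fin L, a l * (if k = l then (1 : ℝ) else 0) = a k := by
  simp only [mul_ite, mul_one, mul_zero, Finset.sum_ite_eq, Finset.mem_univ, if_true]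

/-- Kronecker collapse `Σ_l a_l (δ_{kl} c) = a_k c`. [folklore] -/
theorem sum_mul_ite_delta (k : Fin L) (a : Fin L → ℝ) (c : ℝ) :
    ∑ l : Fin L, a l * (if k = l then c else 0) = a k * c := by
  simp only [mul_ite, mul_zero, Finset.sum_ite_eq, Finset.mem_univ, if_true]

/-- On a bond `j = i + 1`, a sum guarded by `j = l + 1` has the single term `l = i`. [folklore] -/
theorem sum_ite_eq_of_bond {i j : Fin L} (hj : j.val = i.val + 1) (f : Fin L → ℝ) :
    ∑ l : Fin L, (if j.val = l.val + 1 then f l else 0) = f i := by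
  rw [Finset.sum_eq_single i, if_pos hj]
  · intro l _ hl
    rw [if_neg]
    intro h
    exact hl (Fin.ext (by omega))
  · intro h
    exact absurd (Finset.mem_univ i) h

/-- On a bond `j = i + 1`, a sum guarded by `l = i + 1` has the single term `l = j`. [folklore] -/
theorem sum_ite_eq_of_bond' {i j : Fin L} (hj : j.val = i.val + 1) (f : Fin L → ℝ) :
    ∑ l : Fin L, (if l.val = i.val + 1 then f l else 0) = f j := by
  rw [Finset.sum_eq_single j, if_pos hj]
  · intro l _ hl
    rw [if_neg]
    intro h
    exact hl (Fin.ext (by omega))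
  · intro h
    exact absurd (Finset.mem_univ j) h

/-- `Σ_l p_l ∂²Φ/∂q_l∂q_j` on the bond `(i, j = i+1)` of the pinned chain:
`−p_i V''(r) + p_j ∂²Φ/∂q_j² − Σ_{l = j+1} p_l V''(q_l − q_j)`. [folklore] -/
theorem sum_snd_mul_hessPotential_right {i j : Fin L} (hj : j.val = i.val + 1) (x : PhaseSpace L) :
    ∑ l : Fin L, x.2 l * (pinnedChain ω₂ lam β γ).hessPotential L j l x.1 =
      x.2 i * (-(1 + 3 * β * (x.1 j - x.1 i) ^ 2)) + x.2 j * (pinnedChain ω₂ lam β γ).hessPotential L j j x.1 +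
        -(∑ l : Fin L, if l.val = j.val + 1 then x.2 l * (1 + 3 * β * (x.1 l - x.1 j) ^ 2) else 0) := by
  have h1 : (∑ l : Fin L, if j.val = l.val + 1 then x.2 l * (pinnedChain ω₂ lam β γ).hessPotential L j l x.1 else 0) =
      x.2 i * (-(1 + 3 * β * (x.1 j - x.1 i) ^ 2)) := by
    rw [sum_ite_eq_of_bond hj, hessPotential_bond x.1 hj]
  have h2 : (∑ l : Fin L, if l.val = j.val + 1 then x.2 l * (pinnedChain ω₂ lam β γ).hessPotential L j l x.1 else 0) =
      -(∑ l : Fin L, if l.val = j.val + 1 then x.2 l * (1 + 3 * β * (x.1 l - x.1 j) ^ 2) else 0) := by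
    rw [← Finset.sum_neg_distrib]
    refine Finset.sum_congr rfl fun l _ => ?_
    split_ifs with h
    · rw [hessPotential_bond' x.1 h]
      ring
    · simp
  rw [sum_mul_hessPotential, h1, h2]

/-- `Σ_l p_l ∂²Φ/∂q_l∂q_i` on the bond `(i, j = i+1)` of the pinned chain:
`−Σ_{i = l+1} p_l V''(q_i − q_l) + p_i ∂²Φ/∂q_i² − p_j V''(r)`. [folklore] -/
theorem sum_snd_mul_hessPotential_left {i j : Fin L} (hj : j.val = i.val + 1) (x : PhaseSpace L) :
    ∑ l : Fin L, x.2 l * (pinnedChain ω₂ lam β γ).hessPotential L i l x.1 =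
      -(∑ l : Fin L, if i.val = l.val + 1 then x.2 l * (1 + 3 * β * (x.1 i - x.1 l) ^ 2) else 0) +
        x.2 i * (pinnedChain ω₂ lam β γ).hessPotential L i i x.1 + x.2 j * (-(1 + 3 * β * (x.1 j - x.1 i) ^ 2)) := by
  have h1 : (∑ l : Fin L, if i.val = l.val + 1 then x.2 l * (pinnedChain ω₂ lam β γ).hessPotential L i l x.1 else 0) =
      -(∑ l : Fin L, if i.val = l.val + 1 then x.2 l * (1 + 3 * β * (x.1 i - x.1 l) ^ 2) else 0) := by
    rw [← Finset.sum_neg_distrib]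
    refine Finset.sum_congr rfl fun l _ => ?_
    split_ifs with h
    · rw [hessPotential_bond x.1 h]
      ring
    · simp
  have h2 : (∑ l : Fin L, if l.val = i.val + 1 then x.2 l * (pinnedChain ω₂ lam β γ).hessPotential L i l x.1 else 0) =
      x.2 j * (-(1 + 3 * β * (x.1 j - x.1 i) ^ 2)) := by
    rw [sum_ite_eq_of_bond' hj, hessPotential_bond' x.1 hj]
  rw [sum_mul_hessPotential, h1, h2]

/-! ### The Poisson bracket of one bond term with the Hamiltonian -/

/-- **The Poisson bracket of the bond term with the Hamiltonian** (`j = i + 1`, `β ≥ 0`):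
`{H, p_i G + p_j G'} = (p_i² − p_j²) + p_i R_A + p_j R_B` with the explicit `R_A` (free of `p_i`) and `R_B` (free of
`p_j`) of the statement; the only non-literal cancellation is `V''(r) φ(r) = 1`. [folklore] -/
theorem poisson_bond (hβ : 0 ≤ β) {i j : Fin L} (hj : j.val = i.val + 1) (x : PhaseSpace L) :
    poisson ((pinnedChain ω₂ lam β γ).hamiltonian L) (fun y : PhaseSpace L =>
      y.2 i * (y.2 j ^ 2 * (-(6 * β * (y.1 j - y.1 i)) / (1 + 3 * β * (y.1 j - y.1 i) ^ 2) ^ 2) -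
          partialQ j ((pinnedChain ω₂ lam β γ).hamiltonian L) y * (1 / (1 + 3 * β * (y.1 j - y.1 i) ^ 2))) +
        y.2 j * (y.2 i ^ 2 * (-(6 * β * (y.1 j - y.1 i)) / (1 + 3 * β * (y.1 j - y.1 i) ^ 2) ^ 2) +
          partialQ i ((pinnedChain ω₂ lam β γ).hamiltonian L) y * (1 / (1 + 3 * β * (y.1 j - y.1 i) ^ 2)))) x =
      (x.2 i ^ 2 - x.2 j ^ 2) +
        (x.2 i * (x.2 j * (x.2 j ^ 2 * (6 * β * (9 * β * (x.1 j - x.1 i) ^ 2 - 1) / (1 + 3 * β * (x.1 j - x.1 i) ^ 2) ^ 3) -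
            partialQ j (partialQ j ((pinnedChain ω₂ lam β γ).hamiltonian L)) x * (1 / (1 + 3 * β * (x.1 j - x.1 i) ^ 2)) -
            3 * partialQ j ((pinnedChain ω₂ lam β γ).hamiltonian L) x * (-(6 * β * (x.1 j - x.1 i)) / (1 + 3 * β * (x.1 j - x.1 i) ^ 2) ^ 2)) +
          (∑ k : Fin L, if k.val = j.val + 1 then x.2 k * (1 + 3 * β * (x.1 k - x.1 j) ^ 2) else 0) *
            (1 / (1 + 3 * β * (x.1 j - x.1 i) ^ 2))) +
        x.2 j * (x.2 i * (-(x.2 i ^ 2 * (6 * β * (9 * β * (x.1 j - x.1 i) ^ 2 - 1) / (1 + 3 * β * (x.1 j - x.1 i) ^ 2) ^ 3)) +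
            partialQ i (partialQ i ((pinnedChain ω₂ lam β γ).hamiltonian L)) x * (1 / (1 + 3 * β * (x.1 j - x.1 i) ^ 2)) -
            3 * partialQ i ((pinnedChain ω₂ lam β γ).hamiltonian L) x * (-(6 * β * (x.1 j - x.1 i)) / (1 + 3 * β * (x.1 j - x.1 i) ^ 2) ^ 2)) -
          (∑ k : Fin L, if i.val = k.val + 1 then x.2 k * (1 + 3 * β * (x.1 i - x.1 k) ^ 2) else 0) *
            (1 / (1 + 3 * β * (x.1 j - x.1 i) ^ 2)))) := by
  have hV : (1 + 3 * β * (x.1 j - x.1 i) ^ 2) ≠ 0 := (one_add_three_mul_sq_pos hβ _).ne'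
  rw [poisson]
  conv_lhs =>
    simp only [OscillatorChain.partialP_hamiltonian, partialQ_bond hβ, partialP_bond]
    simp only [mul_add, Finset.sum_add_distrib, Finset.sum_sub_distrib, ← mul_assoc, ← Finset.sum_mul]
  rw [sum_snd_mul_delta_sub, sum_snd_mul_hessPotential_right hj, sum_snd_mul_hessPotential_left hj,
    sum_mul_delta, sum_mul_delta, sum_mul_ite_delta, sum_mul_ite_delta, partialQ_partialQ_hamiltonian,
    partialQ_partialQ_hamiltonian]
  linear_combination (x.2 i ^ 2 - x.2 j ^ 2) * mul_one_div_cancel hV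

/-- The Poisson bracket of a guarded bond term: off the bonds it vanishes, on a bond it is `poisson_bond`.
[folklore] -/
theorem poisson_bond_ite (hβ : 0 ≤ β) (i j : Fin L) (x : PhaseSpace L) :
    poisson ((pinnedChain ω₂ lam β γ).hamiltonian L) (fun y : PhaseSpace L => if j.val = i.val + 1 then
      (y.2 i * (y.2 j ^ 2 * (-(6 * β * (y.1 j - y.1 i)) / (1 + 3 * β * (y.1 j - y.1 i) ^ 2) ^ 2) -
          partialQ j ((pinnedChain ω₂ lam β γ).hamiltonian L) y * (1 / (1 + 3 * β * (y.1 j - y.1 i) ^ 2))) +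
        y.2 j * (y.2 i ^ 2 * (-(6 * β * (y.1 j - y.1 i)) / (1 + 3 * β * (y.1 j - y.1 i) ^ 2) ^ 2) +
          partialQ i ((pinnedChain ω₂ lam β γ).hamiltonian L) y * (1 / (1 + 3 * β * (y.1 j - y.1 i) ^ 2))))
      else 0) x =
      if j.val = i.val + 1 then
        (x.2 i ^ 2 - x.2 j ^ 2) +
          (x.2 i * (x.2 j * (x.2 j ^ 2 * (6 * β * (9 * β * (x.1 j - x.1 i) ^ 2 - 1) / (1 + 3 * β * (x.1 j - x.1 i) ^ 2) ^ 3) -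
            partialQ j (partialQ j ((pinnedChain ω₂ lam β γ).hamiltonian L)) x * (1 / (1 + 3 * β * (x.1 j - x.1 i) ^ 2)) -
            3 * partialQ j ((pinnedChain ω₂ lam β γ).hamiltonian L) x * (-(6 * β * (x.1 j - x.1 i)) / (1 + 3 * β * (x.1 j - x.1 i) ^ 2) ^ 2)) +
          (∑ k : Fin L, if k.val = j.val + 1 then x.2 k * (1 + 3 * β * (x.1 k - x.1 j) ^ 2) else 0) *
            (1 / (1 + 3 * β * (x.1 j - x.1 i) ^ 2))) +
          x.2 j * (x.2 i * (-(x.2 i ^ 2 * (6 * β * (9 * β * (x.1 j - x.1 i) ^ 2 - 1) / (1 + 3 * β * (x.1 j - x.1 i) ^ 2) ^ 3)) +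
            partialQ i (partialQ i ((pinnedChain ω₂ lam β γ).hamiltonian L)) x * (1 / (1 + 3 * β * (x.1 j - x.1 i) ^ 2)) -
            3 * partialQ i ((pinnedChain ω₂ lam β γ).hamiltonian L) x * (-(6 * β * (x.1 j - x.1 i)) / (1 + 3 * β * (x.1 j - x.1 i) ^ 2) ^ 2)) -
          (∑ k : Fin L, if i.val = k.val + 1 then x.2 k * (1 + 3 * β * (x.1 i - x.1 k) ^ 2) else 0) *
            (1 / (1 + 3 * β * (x.1 j - x.1 i) ^ 2))))
      else 0 := by
  by_cases hij : j.val = i.val + 1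
  · simp only [if_pos hij]
    exact poisson_bond hβ hij x
  · simp only [if_neg hij]
    exact poisson_const_right _ _ _

/-! ### Registered helper -/

/-- Registered helper sub-goal `helper_thomsonWitnessPoissonBond` of crux stmt-AtomisticToContinuum-11977 (line
`abel-storage-decay`, stub B `stub_bulkAbelGKPositivity`): the Poisson bracket of the guarded bond term of the Thomson
witness with the Hamiltonian (`poisson_bond_ite`, restated notation-free). [folklore] -/
theorem helper_thomsonWitnessPoissonBond : ∀ (ω₂ lam β γ : ℝ), 0 ≤ β → ∀ (L : ℕ) (i j : Fin L) (x : Literature.MathematicalPhysics.KineticTheory.HeatConduction.PhaseSpace L), Literature.MathematicalPhysics.KineticTheory.HeatConduction.poisson ((Literature.MathematicalPhysics.KineticTheory.HeatConduction.pinnedChain ω₂ lam β γ).hamiltonian L) (fun y : Literature.MathematicalPhysics.KineticTheory.HeatConduction.PhaseSpace L => if j.val = i.val + 1 then (y.2 i * (y.2 j ^ 2 * (-(6 * β * (y.1 j - y.1 i)) / (1 + 3 * β * (y.1 j - y.1 i) ^ 2) ^ 2) - Literature.MathematicalPhysics.KineticTheory.HeatConduction.partialQ j ((Literature.MathematicalPhysics.KineticTheory.HeatConduction.pinnedChain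 ω₂ lam β γ).hamiltonian L) y * (1 / (1 + 3 * β * (y.1 j - y.1 i) ^ 2))) + y.2 j * (y.2 i ^ 2 * (-(6 * β * (y.1 j - y.1 i)) / (1 + 3 * β * (y.1 j - y.1 i) ^ 2) ^ 2) + Literature.MathematicalPhysics.KineticTheory.HeatConduction.partialQ i ((Literature.MathematicalPhysics.KineticTheory.HeatConduction.pinnedChain ω₂ lam β γ).hamiltonian L) y * (1 / (1 + 3 * β * (y.1 j - y.1 i) ^ 2)))) else 0) x = if j.val = i.val + 1 then (x.2 i ^ 2 - x.2 j ^ 2) + (x.2 i * (x.2 j * (x.2 j ^ 2 * (6 * β * (9 * β * (x.1 j - x.1 i) ^ 2 - 1) / (1 + 3 * β * (x.1 j - x.1 i) ^ 2) ^ 3) - Literature.MathematicalPhysics.KineticTheory.HeatConduction.partialQ j (Literature.MathematicalPhysics.KineticTheory.HeatConduction.partialQ j ((Literature.MathematicalPhysics.KineticTheory.HeatConduction.pinnedChain ω₂ lam β γ).hamiltonian L)) x * (1 / (1 + 3 * β * (x.1 j - x.1 i) ^ 2)) - 3 * Literature.MathematicalPhysics.KineticTheory.HeatConduction.partialQ j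 ((Literature.MathematicalPhysics.KineticTheory.HeatConduction.pinnedChain ω₂ lam β γ).hamiltonian L) x * (-(6 * β * (x.1 j - x.1 i)) / (1 + 3 * β * (x.1 j - x.1 i) ^ 2) ^ 2)) + (∑ k : Fin L, if k.val = j.val + 1 then x.2 k * (1 + 3 * β * (x.1 k - x.1 j) ^ 2) else 0) * (1 / (1 + 3 * β * (x.1 j - x.1 i) ^ 2))) + x.2 j * (x.2 i * (-(x.2 i ^ 2 * (6 * β * (9 * β * (x.1 j - x.1 i) ^ 2 - 1) / (1 + 3 * β * (x.1 j - x.1 i) ^ 2) ^ 3)) + Literature.MathematicalPhysics.KineticTheory.HeatConduction.partialQ i (Literature.MathematicalPhysics.KineticTheory.HeatConduction.partialQ i ((Literature.MathematicalPhysics.KineticTheory.HeatConduction.pinnedChain ω₂ lam β γ).hamiltonian L)) x * (1 / (1 + 3 * β * (x.1 j - x.1 i) ^ 2)) - 3 * Literature.MathematicalPhysics.KineticTheory.HeatConduction.partialQ i ((Literature.MathematicalPhysics.KineticTheory.HeatConduction.pinnedChain ω₂ lam β γ).hamiltonian L) x * (-(6 * β * (x.1 j - x.1 i)) / (1 + 3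 * β * (x.1 j - x.1 i) ^ 2) ^ 2)) - (∑ k : Fin L, if i.val = k.val + 1 then x.2 k * (1 + 3 * β * (x.1 i - x.1 k) ^ 2) else 0) * (1 / (1 + 3 * β * (x.1 j - x.1 i) ^ 2)))) else 0 :=
  fun _ _ _ _ hβ _ i j x => poisson_bond_ite hβ i j x

end Summit.AtomisticToContinuum.FouriersLaw.Theorems.NoisyFourier.ThomsonWitness.Algebra

end
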